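import Summits.Ventures.LatticeQCDFlow.Scaling.ReplicaExchangeModeTorpid
import Summits.Ventures.LatticeQCDFlow.Scaling.ReplicaExchangeBareSampler

/-!
HONEST FRAMING: exact (Metropolis-corrected) sampling algorithms for lattice gauge theory; figures
of merit are autocorrelation/cost numbers at stated couplings and volumes; no continuum-physics
claim.

# ExchangeSchemeCutMixingFloor — NO SWAP SCHEDULE, REVERSIBLE OR NOT, CARRIES SECTOR INFORMATION ACROSS A CUT OF THE
# LADDER FASTER THAN ITS STATIONARY CROSSING RATE: FOR `P = t·Q + (1−t)·Upd_w` WITH `π̃` MERELY STATIONARY FOR THE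
# EXCHANGE MOVE `Q` AND SECTOR-FROZEN REPLICAS BELOW THE CUT `j`, EVERY EVENT `T` DETERMINED BY THE NUMBER OF REPLICAS
# BELOW THE CUT SITTING IN `A` HAS `d(n) ≤ ¼ ⇒ π̃(T) ≤ 4n·t·r_j(Q)` (`r_j(Q)` = THE `π̃`-RATE AT WHICH `Q` CHANGES THAT
# NUMBER) AND `1 ≤ 4n·t·c` IF `Q` CHANGES IT WITH PROBABILITY `≤ c` FROM EVERY STATE; FOR THE METROPOLIS LADDER
# `r_j ≤ α_j/K` AND `c = 1/K`: `t_mix ≥ K·π̃(T)/(4tα_j)` AND `t_mix ≥ K/(4t)` (lean-2 GEN-20, ours)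

Venture-side (OURS).  Cell `lqcd-flow` (pub-lqcd), unit `pub-lqcd-lean-2-g20`, 2026-08-25.  Chapter H (universal
ceilings).  `ExchangeSchemeCutCeiling` bounds the SPECTRAL GAP of a `π̃`-REVERSIBLE exchange scheme by the Dirichlet
form across a cut; production replica exchange often runs NON-reversible swap schedules (deterministic even/odd
sweeps, lifted "non-reversible parallel tempering"), for which the spectral gap is not the right currency.  This file
drops reversibility of the exchange move: only STATIONARITY of `π̃ = ⊗_k μ_k` under `Q` is used, through
Levin–Peres–Wilmer Theorem 7.4 (`t_mix ≥ 1/(4Φ⋆)`, PROVED in the tree).  State space `Fin (K+1) → S` (`S` finite),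
`Upd_w = prodKernel w M` (weights `w`, `M_k` row-stochastic `μ_k`-reversible), `P = t·Q + (1−t)·Upd_w`; a cut
`j : Fin K`; `N_j(x) = sectorCountBelow A j x = #{k > j : x_k ∈ A}`; the replicas below the cut are SECTOR-FROZEN
(`M_k(u,v) ≠ 0 ⇒ (u ∈ A ↔ v ∈ A)` for `k > j`); a COUNT EVENT is a set `T` of states with
`x ∈ T, y ∉ T ⇒ N_j(y) ≠ N_j(x)`; `r_j(Q) = Σ_x π̃(x)·Q(x, {N_j ≠ N_j(x)})`; `α_j = ptFinAcc μ j`.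

## What is proved (finite-chain vocabulary of `Literature.Probability.MarkovChains`)

* §1 `sectorCountBelow`, `sectorCountBelow_update` (one coordinate), `lt_levelSwap_iff`,
  `sectorCountBelow_comp_levelSwap` (a swap away from the cut keeps `N_j`), `prodKernel_sectorCountBelow_eq`
  (sector-frozen replicas below the cut: `Upd_w` keeps `N_j`); generic `edgeMeasure_le_changeRate`
  (`Q_π(T,Tᶜ) ≤ Σ_x π(x)P(x,{f ≠ f(x)})` for an `f`-determined `T`) and `edgeMeasure_le_mul_of_pointwise`.
* §2 **`exchangeCut_mixing_floor`** — `π̃` stationary for `Q`, `0 ≤ t ≤ 1`, `w` a probability vector, frozen below the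
  cut, `T` a count event with `0 < π̃(T) ≤ ½`, `d(n) ≤ ¼` ⇒ `π̃(T) ≤ 4n·t·r_j(Q)`;
  **`exchangeCut_mixing_floor_pointwise`** — if moreover `Q(x, {N_j ≠ N_j(x)}) ≤ c` for every `x` then `1 ≤ 4n·t·c`.
* §3 THE METROPOLIS LADDER (`Q = ptBareSwap μ`, `P = ptBareSampler t μ M`): `ptBareSwap_changeRate_le`
  (`r_j ≤ α_j/K`), `ptBareSwap_change_le_pointwise` (`≤ 1/K` from every state); **`ptBareCut_mixing_floor`**
  (`π̃(T) ≤ 4n·t·α_j/K`) and **`ptBareCut_mixing_floor_ballistic`** (`K ≤ 4n·t`).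

Reading (no numerics implied): with the four files of this chapter the exchange side is covered two ways — currency
(spectral gap for reversible schemes / mixing time for merely stationary ones) × statistic (the sector count:
`ExchangeSchemeSectorCeiling`, `SectorCountMixingFloor`; the count below a cut: `ExchangeSchemeCutCeiling`, this file).
A poorly overlapping adjacent pair (`α_j` small) throttles every scheme that must pass sector labels across it, however
the swaps are scheduled; and no adjacent schedule delivers a label to the cold end in fewer than order `K/t` steps.
NOT CLAIMED: floors on the gap of non-reversible schemes (not defined here); non-adjacent or map-assisted exchange moves
changing several labels at once (they enter only through `r_j(Q)` / `c`); continuous configuration spaces; anything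
measured.  Literature grade (cell rule): KNOWN MECHANISM (conductance bound on mixing, Levin–Peres–Wilmer Thm 7.4, PROVED
in the tree), NEW TYPING (per-cut form for arbitrary stationary exchange schedules; the acceptance instance); nothing
cited as a fact; no new bib keys.
-/

noncomputable section

open Finset Function
open Literature.Probability.MarkovChains

namespace Summit.Ventures.LatticeQCDFlow.Scaling

/-! ## §0 Two generic flow bounds -/

section Generic

variable {X : Type*} [Fintype X] [DecidableEq X] {π : X → ℝ} {P : X → X → ℝ}

/-- **The flow out of an `f`-determined set is at most the rate at which `f` changes:**
`Q_π(T,Tᶜ) ≤ Σ_x π(x)·P(x, {y : f(y) ≠ f(x)})` (`π, P ≥ 0`; `x ∈ T, y ∉ T ⇒ f(y) ≠ f(x)`). [ours] -/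
theorem edgeMeasure_le_changeRate (hπ : ∀ x, 0 ≤ π x) (hP : ∀ x y, 0 ≤ P x y) {R : Type*} [DecidableEq R]
    (f : X → R)
    {T : Finset X} (hT : ∀ x ∈ T, ∀ y, y ∉ T → f y ≠ f x) :
    edgeMeasure π P T Tᶜ ≤ ∑ x, π x * ∑ y ∈ univ.filter (fun y => f y ≠ f x), P x y := by
  unfold edgeMeasure
  calc ∑ x ∈ T, ∑ y ∈ Tᶜ, π x * P x y ≤ ∑ x ∈ T, ∑ y ∈ univ.filter (fun y => f y ≠ f x), π x * P x y := by
        refine sum_le_sum fun x hx => sum_le_sum_of_subset_of_nonneg (fun y hy => ?_)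
          (fun y _ _ => mul_nonneg (hπ x) (hP x y))
        rw [mem_compl] at hy
        exact mem_filter.mpr ⟨mem_univ _, hT x hx y hy⟩
    _ ≤ ∑ x, ∑ y ∈ univ.filter (fun y => f y ≠ f x), π x * P x y :=
        sum_le_sum_of_subset_of_nonneg (subset_univ _) fun x _ _ =>
          sum_nonneg fun y _ => mul_nonneg (hπ x) (hP x y)
    _ = _ := sum_congr rfl fun x _ => by rw [mul_sum]

/-- **A pointwise escape bound gives `Q_π(T,Tᶜ) ≤ c·π(T)`:** if `P(x, {f ≠ f(x)}) ≤ c` for every `x ∈ T`. [ours] -/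
theorem edgeMeasure_le_mul_of_pointwise (hπ : ∀ x, 0 ≤ π x) (hP : ∀ x y, 0 ≤ P x y) {R : Type*} [DecidableEq R]
    (f : X → R)
    {T : Finset X} (hT : ∀ x ∈ T, ∀ y, y ∉ T → f y ≠ f x) {c : ℝ}
    (hc : ∀ x ∈ T, ∑ y ∈ univ.filter (fun y => f y ≠ f x), P x y ≤ c) :
    edgeMeasure π P T Tᶜ ≤ c * ∑ x ∈ T, π x := by
  unfold edgeMeasure
  rw [mul_sum]
  refine sum_le_sum fun x hx => ?_
  calc ∑ y ∈ Tᶜ, π x * P x y ≤ ∑ y ∈ univ.filter (fun y => f y ≠ f x), π x * P x y := by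
        refine sum_le_sum_of_subset_of_nonneg (fun y hy => ?_) (fun y _ _ => mul_nonneg (hπ x) (hP x y))
        rw [mem_compl] at hy
        exact mem_filter.mpr ⟨mem_univ _, hT x hx y hy⟩
    _ = π x * ∑ y ∈ univ.filter (fun y => f y ≠ f x), P x y := by rw [mul_sum]
    _ ≤ π x * c := mul_le_mul_of_nonneg_left (hc x hx) (hπ x)
    _ = c * π x := mul_comm _ _

end Generic

variable {S : Type*} [Fintype S] [DecidableEq S] {K : ℕ} {μ : Fin (K + 1) → S → ℝ}
  {M : Fin (K + 1) → S → S → ℝ} {w : Fin (K + 1) → ℝ} {t : ℝ}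
  {Q : Matrix (Fin (K + 1) → S) (Fin (K + 1) → S) ℝ}

/-! ## §1 The number of replicas below a cut sitting in `A` -/

/-- `N_j(x) = #{k > j : x_k ∈ A}`, the number of replicas strictly below the cut `j` (levels `j+1, …, K`) whose
configuration lies in `A` (as a real number). [ours] -/
def sectorCountBelow (A : Finset S) (j : Fin K) (x : Fin (K + 1) → S) : ℝ :=
  ∑ k : Fin (K + 1), if (j : ℕ) < k ∧ x k ∈ A then 1 else 0

omit [Fintype S] in
/-- **One coordinate update changes `N_j` by that coordinate's indicator change, and only below the cut.** [ours] -/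
theorem sectorCountBelow_update (A : Finset S) (j : Fin K) (x : Fin (K + 1) → S) (k : Fin (K + 1)) (v : S) :
    sectorCountBelow A j (update x k v) = sectorCountBelow A j x
      + (if (j : ℕ) < k then ((if v ∈ A then (1 : ℝ) else 0) - (if x k ∈ A then (1 : ℝ) else 0)) else 0) := by
  unfold sectorCountBelow
  have h : ∀ k' : Fin (K + 1), (if (j : ℕ) < k' ∧ update x k v k' ∈ A then (1 : ℝ) else 0)
      = (if (j : ℕ) < k' ∧ x k' ∈ A then (1 : ℝ) else 0)
        + (if k' = k then (if (j : ℕ) < k then ((if v ∈ A then (1 : ℝ) else 0) - (if x k ∈ A then (1 : ℝ) else 0))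
            else 0) else 0) := by
    intro k'
    by_cases hk : k' = k
    · subst hk
      rw [update_self, if_pos rfl]
      by_cases hj : (j : ℕ) < k' <;> by_cases hv : v ∈ A <;> by_cases hx : x k' ∈ A <;> simp [hj, hv, hx]
    · rw [update_of_ne hk, if_neg hk, add_zero]
  rw [sum_congr rfl fun k' _ => h k', sum_add_distrib, Finset.sum_ite_eq' univ k, if_pos (mem_univ _)]

/-- A transposition of levels away from the cut preserves "below the cut". [ours] -/
theorem lt_levelSwap_iff {i j : Fin K} (hij : i ≠ j) (k : Fin (K + 1)) :
    (j : ℕ) < ((levelSwap i k : Fin (K + 1)) : ℕ) ↔ (j : ℕ) < k := by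
  have hij' : (i : ℕ) ≠ j := fun e => hij (Fin.ext e)
  unfold levelSwap
  by_cases h1 : k = i.castSucc
  · rw [h1, Equiv.swap_apply_left, Fin.val_succ, Fin.val_castSucc]; omega
  · by_cases h2 : k = i.succ
    · rw [h2, Equiv.swap_apply_right, Fin.val_succ, Fin.val_castSucc]; omega
    · rw [Equiv.swap_apply_of_ne_of_ne h1 h2]

omit [Fintype S] in
/-- **A swap of two levels on the same side of the cut keeps `N_j`.** [ours] -/
theorem sectorCountBelow_comp_levelSwap {i j : Fin K} (hij : i ≠ j) (A : Finset S) (x : Fin (K + 1) → S) :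
    sectorCountBelow A j (x ∘ levelSwap i) = sectorCountBelow A j x := by
  unfold sectorCountBelow
  calc ∑ k : Fin (K + 1), (if (j : ℕ) < k ∧ (x ∘ levelSwap i) k ∈ A then (1 : ℝ) else 0)
      = ∑ k : Fin (K + 1), (if (j : ℕ) < ((levelSwap i k : Fin (K + 1)) : ℕ) ∧ x (levelSwap i k) ∈ A
          then (1 : ℝ) else 0) :=
        sum_congr rfl fun k _ => by simp only [Function.comp_apply, lt_levelSwap_iff hij k]; rfl
    _ = _ := Equiv.sum_comp (levelSwap i) (fun k => if (j : ℕ) < k ∧ x k ∈ A then (1 : ℝ) else 0)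

omit [Fintype S] in
/-- **Sector-frozen replicas below the cut: the product update keeps `N_j`** (`Upd_w(x,y) ≠ 0 ⇒ N_j(y) = N_j(x)`).
[ours] -/
theorem prodKernel_sectorCountBelow_eq {A : Finset S} {j : Fin K}
    (hfrozen : ∀ k : Fin (K + 1), (j : ℕ) < k → ∀ u v, M k u v ≠ 0 → (u ∈ A ↔ v ∈ A))
    (w : Fin (K + 1) → ℝ) (x y : Fin (K + 1) → S) (hxy : prodKernel w M x y ≠ 0) :
    sectorCountBelow A j y = sectorCountBelow A j x := by
  rw [prodKernel_apply] at hxy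
  obtain ⟨k, -, hk⟩ := Finset.exists_ne_zero_of_sum_ne_zero hxy
  have hck : coordKernel M k x y ≠ 0 := fun h => hk (by rw [h, mul_zero])
  unfold coordKernel at hck
  by_cases hy : y = update x k (y k)
  · rw [if_pos hy] at hck
    rw [hy, sectorCountBelow_update]
    by_cases hj : (j : ℕ) < k
    · rw [if_pos hj]
      have hiff := hfrozen k hj (x k) (y k) hck
      by_cases hxk : x k ∈ A
      · rw [if_pos hxk, if_pos (hiff.mp hxk)]; ring
      · rw [if_neg hxk, if_neg (fun h => hxk (hiff.mpr h))]; ring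
    · rw [if_neg hj, add_zero]
  · exact absurd (if_neg hy) hck

/-! ## §2 The per-cut mixing floor for every stationary exchange scheme -/

section Scheme

variable (hμ : ∀ k x, 0 < μ k x) (hμ1 : ∀ k, ∑ u, μ k u = 1) (hM : ∀ k, IsRowStochastic (M k))
  (hMrev : ∀ k, DetailedBalance (μ k) (M k)) (hw0 : ∀ k, 0 ≤ w k) (hw1 : ∑ k, w k = 1) (ht0 : 0 ≤ t) (ht1 : t ≤ 1)
  (hQ : IsRowStochastic Q) (hQst : IsStationary (tensorFun μ) Q) {A : Finset S} {j : Fin K}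
  (hfrozen : ∀ k : Fin (K + 1), (j : ℕ) < k → ∀ u v, M k u v ≠ 0 → (u ∈ A ↔ v ∈ A))
  {T : Finset (Fin (K + 1) → S)} (hT : ∀ x ∈ T, ∀ y, y ∉ T → sectorCountBelow A j y ≠ sectorCountBelow A j x)
  (hT0 : 0 < ∑ x ∈ T, tensorFun μ x) (hT1 : ∑ x ∈ T, tensorFun μ x ≤ 1 / 2)
include hμ hμ1 hM hMrev hw0 hw1 ht0 ht1 hQ hQst hfrozen hT hT0 hT1

/-- **THE PER-CUT MIXING FLOOR, NO REVERSIBILITY OF THE EXCHANGE MOVE:** `d(n) ≤ ¼ ⇒ π̃(T) ≤ 4n·t·r_j(Q)` for every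
count event `T` below the cut with `0 < π̃(T) ≤ ½`. [ours] -/
theorem exchangeCut_mixing_floor {n : ℕ}
    (hn : worstTvDist (fun x y : Fin (K + 1) → S => t * Q x y + (1 - t) * prodKernel w M x y) (tensorFun μ) n ≤ 1 / 4) :
    ∑ x ∈ T, tensorFun μ x ≤ 4 * n * (t * ∑ x, tensorFun μ x
      * ∑ y ∈ univ.filter (fun y => sectorCountBelow A j y ≠ sectorCountBelow A j x), Q x y) := by
  have hU := prodKernel_isRowStochastic M w hw0 hw1 hM
  have hUst : IsStationary (tensorFun μ) (prodKernel w M) := (prodKernel_detailedBalance hMrev w).isStationary hU.2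
  have hP : IsRowStochastic (fun x y : Fin (K + 1) → S => t * Q x y + (1 - t) * prodKernel w M x y) := by
    refine ⟨fun x y => add_nonneg (mul_nonneg ht0 (hQ.1 x y)) (mul_nonneg (by linarith) (hU.1 x y)), fun x => ?_⟩
    simp only
    rw [sum_add_distrib, ← mul_sum, ← mul_sum, hQ.2 x, hU.2 x]; ring
  have hst : IsStationary (tensorFun μ) (fun x y : Fin (K + 1) → S => t * Q x y + (1 - t) * prodKernel w M x y) := by
    intro y
    have h1 := hQst y
    have h2 := hUst y
    calc ∑ x, tensorFun μ x * (t * Q x y + (1 - t) * prodKernel w M x y)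
        = t * ∑ x, tensorFun μ x * Q x y + (1 - t) * ∑ x, tensorFun μ x * prodKernel w M x y := by
          rw [mul_sum, mul_sum, ← sum_add_distrib]; exact sum_congr rfl fun x _ => by ring
      _ = tensorFun μ y := by rw [h1, h2]; ring
  have hπ0 : ∀ x, 0 ≤ tensorFun μ x := fun x => (tensorFun_pos hμ x).le
  have h := LevinPeres2017_thm_7_4_set hP hst hπ0 (sum_tensorFun_eq_one μ hμ1) hT0 hT1 hn
  unfold bottleneckRatio at h
  -- the flow: the update part never leaves a count event, the exchange part is bounded by its change rate
  have hflowU : edgeMeasure (tensorFun μ) (prodKernel w M) T Tᶜ = 0 := by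
    refine sum_eq_zero fun x hx => sum_eq_zero fun y hy => ?_
    rw [mem_compl] at hy
    by_cases hxy : prodKernel w M x y = 0
    · rw [hxy, mul_zero]
    · exact absurd (prodKernel_sectorCountBelow_eq hfrozen w x y hxy) (hT x hx y hy)
  have hflowQ := edgeMeasure_le_changeRate hπ0 hQ.1 (sectorCountBelow A j) hT
  have hflow : edgeMeasure (tensorFun μ) (fun x y : Fin (K + 1) → S => t * Q x y + (1 - t) * prodKernel w M x y) T Tᶜ
      = t * edgeMeasure (tensorFun μ) Q T Tᶜ + (1 - t) * edgeMeasure (tensorFun μ) (prodKernel w M) T Tᶜ := by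
    unfold edgeMeasure
    rw [mul_sum, mul_sum, ← sum_add_distrib]
    refine sum_congr rfl fun x _ => ?_
    rw [mul_sum, mul_sum, ← sum_add_distrib]
    exact sum_congr rfl fun y _ => by ring
  rw [hflow, hflowU, mul_zero, add_zero] at h
  rw [← mul_div_assoc, le_div_iff₀ hT0, one_mul] at h
  calc ∑ x ∈ T, tensorFun μ x ≤ 4 * n * (t * edgeMeasure (tensorFun μ) Q T Tᶜ) := h
    _ ≤ _ := by
        refine mul_le_mul_of_nonneg_left (mul_le_mul_of_nonneg_left hflowQ ht0) (by positivity)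

/-- **THE POINTWISE FORM: `d(n) ≤ ¼ ⇒ 1 ≤ 4n·t·c`** whenever `Q(x, {N_j ≠ N_j(x)}) ≤ c` for every `x ∈ T` — independent
of the mass of the count event. [ours] -/
theorem exchangeCut_mixing_floor_pointwise {c : ℝ}
    (hc : ∀ x ∈ T, ∑ y ∈ univ.filter (fun y => sectorCountBelow A j y ≠ sectorCountBelow A j x), Q x y ≤ c) {n : ℕ}
    (hn : worstTvDist (fun x y : Fin (K + 1) → S => t * Q x y + (1 - t) * prodKernel w M x y) (tensorFun μ) n ≤ 1 / 4) :
    1 ≤ 4 * n * (t * c) := by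
  have hU := prodKernel_isRowStochastic M w hw0 hw1 hM
  have hUst : IsStationary (tensorFun μ) (prodKernel w M) := (prodKernel_detailedBalance hMrev w).isStationary hU.2
  have hP : IsRowStochastic (fun x y : Fin (K + 1) → S => t * Q x y + (1 - t) * prodKernel w M x y) := by
    refine ⟨fun x y => add_nonneg (mul_nonneg ht0 (hQ.1 x y)) (mul_nonneg (by linarith) (hU.1 x y)), fun x => ?_⟩
    simp only
    rw [sum_add_distrib, ← mul_sum, ← mul_sum, hQ.2 x, hU.2 x]; ring
  have hst : IsStationary (tensorFun μ) (fun x y : Fin (K + 1) → S => t * Q x y + (1 - t) * prodKernel w M x y) := by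
    intro y
    have h1 := hQst y
    have h2 := hUst y
    calc ∑ x, tensorFun μ x * (t * Q x y + (1 - t) * prodKernel w M x y)
        = t * ∑ x, tensorFun μ x * Q x y + (1 - t) * ∑ x, tensorFun μ x * prodKernel w M x y := by
          rw [mul_sum, mul_sum, ← sum_add_distrib]; exact sum_congr rfl fun x _ => by ring
      _ = tensorFun μ y := by rw [h1, h2]; ring
  have hπ0 : ∀ x, 0 ≤ tensorFun μ x := fun x => (tensorFun_pos hμ x).le
  have h := LevinPeres2017_thm_7_4_set hP hst hπ0 (sum_tensorFun_eq_one μ hμ1) hT0 hT1 hn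
  unfold bottleneckRatio at h
  have hflowU : edgeMeasure (tensorFun μ) (prodKernel w M) T Tᶜ = 0 := by
    refine sum_eq_zero fun x hx => sum_eq_zero fun y hy => ?_
    rw [mem_compl] at hy
    by_cases hxy : prodKernel w M x y = 0
    · rw [hxy, mul_zero]
    · exact absurd (prodKernel_sectorCountBelow_eq hfrozen w x y hxy) (hT x hx y hy)
  have hflowQ := edgeMeasure_le_mul_of_pointwise hπ0 hQ.1 (sectorCountBelow A j) hT hc
  have hflow : edgeMeasure (tensorFun μ) (fun x y : Fin (K + 1) → S => t * Q x y + (1 - t) * prodKernel w M x y) T Tᶜ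
      = t * edgeMeasure (tensorFun μ) Q T Tᶜ + (1 - t) * edgeMeasure (tensorFun μ) (prodKernel w M) T Tᶜ := by
    unfold edgeMeasure
    rw [mul_sum, mul_sum, ← sum_add_distrib]
    refine sum_congr rfl fun x _ => ?_
    rw [mul_sum, mul_sum, ← sum_add_distrib]
    exact sum_congr rfl fun y _ => by ring
  rw [hflow, hflowU, mul_zero, add_zero] at h
  calc (1 : ℝ) ≤ 4 * n * (t * edgeMeasure (tensorFun μ) Q T Tᶜ / ∑ x ∈ T, tensorFun μ x) := h
    _ ≤ 4 * n * (t * c) := by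
        refine mul_le_mul_of_nonneg_left ?_ (by positivity)
        rw [mul_div_assoc]
        refine mul_le_mul_of_nonneg_left ?_ ht0
        rw [div_le_iff₀ hT0]
        exact hflowQ

end Scheme

/-! ## §3 The Metropolis ladder: the crossing rate is the pair's acceptance -/

section Ladder

variable {A : Finset S} {j : Fin K}

/-- From every state the Metropolis swap move changes `N_j` with probability at most `1/K` (the pair `(j, j+1)` must
be proposed). [ours] -/
theorem ptBareSwap_change_le_pointwise (μ : Fin (K + 1) → S → ℝ) (x : Fin (K + 1) → S) :
    ∑ y ∈ univ.filter (fun y => sectorCountBelow A j y ≠ sectorCountBelow A j x), ptBareSwap μ x y ≤ 1 / K := by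
  have hKpos : (0 : ℝ) < K := Nat.cast_pos.mpr (Fin.pos j)
  -- off the diagonal the kernel is dominated by the proposal
  have h1 : ∀ y ∈ univ.filter (fun y => sectorCountBelow A j y ≠ sectorCountBelow A j x),
      ptBareSwap μ x y ≤ ∑ i : Fin K, (if y = x ∘ levelSwap i then (1 : ℝ) / K else 0) := by
    intro y hy
    have hyx : y ≠ x := fun e => (mem_filter.mp hy).2 (by rw [e])
    unfold ptBareSwap
    rw [mhKernel_of_ne hyx]
    exact mhRate_le _ _ _ _
  refine (sum_le_sum h1).trans ?_
  rw [sum_comm]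
  -- each transposition contributes at most `1/K`, and only the one at the cut contributes at all
  have h2 : ∀ i : Fin K, ∑ y ∈ univ.filter (fun y => sectorCountBelow A j y ≠ sectorCountBelow A j x),
      (if y = x ∘ levelSwap i then (1 : ℝ) / K else 0) = if i = j then
        (if sectorCountBelow A j (x ∘ levelSwap j) ≠ sectorCountBelow A j x then (1 : ℝ) / K else 0) else 0 := by
    intro i
    rw [Finset.sum_ite_eq' (univ.filter (fun y => sectorCountBelow A j y ≠ sectorCountBelow A j x)) (x ∘ levelSwap i)
      (fun _ => (1 : ℝ) / K)]
    by_cases hi : i = j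
    · subst hi; simp only [mem_filter, mem_univ, true_and, if_true]
    · rw [if_neg hi, if_neg]
      rw [mem_filter, sectorCountBelow_comp_levelSwap hi]
      exact fun h => h.2 rfl
  rw [sum_congr rfl fun i _ => h2 i, Finset.sum_ite_eq' univ j, if_pos (mem_univ _)]
  split_ifs
  · exact le_rfl
  · positivity

variable (hμ : ∀ k x, 0 < μ k x)
include hμ

/-- **`r_j(Sw) ≤ α_j/K`:** in stationarity the Metropolis swap move changes `N_j` at rate at most the acceptance of the
pair `(j, j+1)` divided by `K`. [ours] -/
theorem ptBareSwap_changeRate_le :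
    ∑ x, tensorFun μ x * ∑ y ∈ univ.filter (fun y => sectorCountBelow A j y ≠ sectorCountBelow A j x), ptBareSwap μ x y
      ≤ ptFinAcc μ j / K := by
  have hKpos : (0 : ℝ) < K := Nat.cast_pos.mpr (Fin.pos j)
  unfold ptFinAcc
  rw [Finset.sum_div]
  refine sum_le_sum fun x _ => ?_
  rw [mul_sum]
  -- off the diagonal `π̃(x)Sw(x,y) = T(x,y)·min{π̃(x), π̃(y)}`
  have h1 : ∀ y ∈ univ.filter (fun y => sectorCountBelow A j y ≠ sectorCountBelow A j x),
      tensorFun μ x * ptBareSwap μ x y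
        = ∑ i : Fin K, (if y = x ∘ levelSwap i then (1 : ℝ) / K * min (tensorFun μ x) (tensorFun μ y) else 0) := by
    intro y hy
    have hyx : y ≠ x := fun e => (mem_filter.mp hy).2 (by rw [e])
    rw [tensorFun_mul_ptBareSwap hμ hyx]
    unfold ptBareProposal
    rw [sum_mul]
    exact sum_congr rfl fun i _ => by split_ifs <;> simp
  rw [sum_congr rfl h1, sum_comm]
  have h2 : ∀ i : Fin K, ∑ y ∈ univ.filter (fun y => sectorCountBelow A j y ≠ sectorCountBelow A j x),
      (if y = x ∘ levelSwap i then (1 : ℝ) / K * min (tensorFun μ x) (tensorFun μ y) else 0) = if i = j then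
        (if sectorCountBelow A j (x ∘ levelSwap j) ≠ sectorCountBelow A j x
          then (1 : ℝ) / K * min (tensorFun μ x) (tensorFun μ (x ∘ levelSwap j)) else 0) else 0 := by
    intro i
    rw [Finset.sum_ite_eq' (univ.filter (fun y => sectorCountBelow A j y ≠ sectorCountBelow A j x)) (x ∘ levelSwap i)
      (fun y => (1 : ℝ) / K * min (tensorFun μ x) (tensorFun μ y))]
    by_cases hi : i = j
    · subst hi; simp only [mem_filter, mem_univ, true_and, if_true]
    · rw [if_neg hi, if_neg]
      rw [mem_filter, sectorCountBelow_comp_levelSwap hi]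
      exact fun h => h.2 rfl
  rw [sum_congr rfl fun i _ => h2 i, Finset.sum_ite_eq' univ j, if_pos (mem_univ _)]
  have hmin : 0 ≤ min (tensorFun μ x) (tensorFun μ (x ∘ levelSwap j)) :=
    le_min (tensorFun_pos hμ _).le (tensorFun_pos hμ _).le
  split_ifs
  · exact le_of_eq (by ring)
  · positivity

variable (hμ1 : ∀ k, ∑ u, μ k u = 1) (hM : ∀ k, IsRowStochastic (M k)) (hMrev : ∀ k, DetailedBalance (μ k) (M k))
  (ht0 : 0 ≤ t) (ht1 : t ≤ 1) (hfrozen : ∀ k : Fin (K + 1), (j : ℕ) < k → ∀ u v, M k u v ≠ 0 → (u ∈ A ↔ v ∈ A))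
  {T : Finset (Fin (K + 1) → S)} (hT : ∀ x ∈ T, ∀ y, y ∉ T → sectorCountBelow A j y ≠ sectorCountBelow A j x)
  (hT0 : 0 < ∑ x ∈ T, tensorFun μ x) (hT1 : ∑ x ∈ T, tensorFun μ x ≤ 1 / 2)
include hμ1 hM hMrev ht0 ht1 hfrozen hT hT0 hT1

/-- **THE METROPOLIS LADDER: `d(n) ≤ ¼ ⇒ π̃(T) ≤ 4n·t·α_j/K`** — `t_mix ≥ K·π̃(T)/(4tα_j)` for every count event below a
cut above sector-frozen replicas. [ours] -/
theorem ptBareCut_mixing_floor {n : ℕ} (hn : worstTvDist (ptBareSampler t μ M) (tensorFun μ) n ≤ 1 / 4) :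
    ∑ x ∈ T, tensorFun μ x ≤ 4 * n * (t * (ptFinAcc μ j / K)) := by
  have hw0 : ∀ _k : Fin (K + 1), (0 : ℝ) ≤ 1 / (K + 1) := fun _ => by positivity
  have h := exchangeCut_mixing_floor hμ hμ1 hM hMrev hw0 (sum_uniform_weight K) ht0 ht1 (ptBareSwap_isRowStochastic hμ)
    ((ptBareSwap_detailedBalance hμ).isStationary (ptBareSwap_isRowStochastic hμ).2) hfrozen hT hT0 hT1
    (n := n) (by rwa [show ptBareSampler t μ M = fun x y => t * ptBareSwap μ x y
      + (1 - t) * prodKernel (fun _ : Fin (K + 1) => (1 : ℝ) / (K + 1)) M x y from rfl] at hn)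
  exact h.trans (mul_le_mul_of_nonneg_left (mul_le_mul_of_nonneg_left (ptBareSwap_changeRate_le hμ) ht0)
    (by positivity))

/-- **`d(n) ≤ ¼ ⇒ K ≤ 4n·t`:** no adjacent Metropolis ladder delivers a sector label across a cut in fewer than `K/(4t)`
steps (some count event below the cut having mass in `(0, ½]`). [ours] -/
theorem ptBareCut_mixing_floor_ballistic {n : ℕ} (hn : worstTvDist (ptBareSampler t μ M) (tensorFun μ) n ≤ 1 / 4) :
    (K : ℝ) ≤ 4 * n * t := by
  have hKpos : (0 : ℝ) < K := Nat.cast_pos.mpr (Fin.pos j)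
  have hw0 : ∀ _k : Fin (K + 1), (0 : ℝ) ≤ 1 / (K + 1) := fun _ => by positivity
  have h := exchangeCut_mixing_floor_pointwise hμ hμ1 hM hMrev hw0 (sum_uniform_weight K) ht0 ht1
    (ptBareSwap_isRowStochastic hμ) ((ptBareSwap_detailedBalance hμ).isStationary (ptBareSwap_isRowStochastic hμ).2)
    hfrozen hT hT0 hT1 (c := 1 / K) (fun x _ => ptBareSwap_change_le_pointwise μ x) (n := n)
    (by rwa [show ptBareSampler t μ M = fun x y => t * ptBareSwap μ x y
      + (1 - t) * prodKernel (fun _ : Fin (K + 1) => (1 : ℝ) / (K + 1)) M x y from rfl] at hn)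
  rw [← mul_assoc, mul_one_div, le_div_iff₀ hKpos, one_mul] at h
  exact h

end Ladder

end Summit.Ventures.LatticeQCDFlow.Scaling

end
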